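import Summits.Ventures.PercRepro.RankLevelSetRuleQElevenCertDefsHi2

/-!
# PercRepro — THE PARTIAL PRODUCTS OF THE UPPER CERTIFICATE OF THE FAMILY `k = 11` (p4, gen 25; C-044; paper §13.7): the two identities
`N^h·na + D^h·nb = P^h` (`h = E, F`; the upper convergent, eighths of the short factor), each one `ring` with the short half-factor on the left.
No `sorry`; axioms standard.
-/

namespace PercRepro

set_option maxHeartbeats 6400000 in
set_option maxRecDepth 16384 in
/-- The partial product identity E of the upper certificate: `N_17^E·na + D_17^E·nb` in `(q, m)` — the short part
(15 + 17 monomials) on the left of each product. -/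
lemma eleven_upper_prodE (q m : ℚ) :
    cfSeventeenN8E q m * naEleven q m + cfSeventeenD8E q m * nbEleven q m = pUpperElevenE q m := by
  unfold cfSeventeenN8E cfSeventeenD8E naEleven nbEleven pUpperElevenE; ring

set_option maxHeartbeats 6400000 in
set_option maxRecDepth 16384 in
/-- The partial product identity F of the upper certificate: `N_17^F·na + D_17^F·nb` in `(q, m)` — the short part
(16 + 17 monomials) on the left of each product. -/
lemma eleven_upper_prodF (q m : ℚ) :
    cfSeventeenN8F q m * naEleven q m + cfSeventeenD8F q m * nbEleven q m = pUpperElevenF q m := by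
  unfold cfSeventeenN8F cfSeventeenD8F naEleven nbEleven pUpperElevenF; ring

end PercRepro
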